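import Summits.Ventures.HSemireg.Pad4FirstOrderModelDemandW

/-!
# Venture HSemireg — THEOREM L^ζ step S2a: the LOWER RAY RULE in the first-order model (THEOREM C′ «only if» at an
# `N`-constituent; companion of `Pad4FirstOrderModel.lean`, row 716; TIER-2 step S2a, director-hodge g9 «S2a GO», cell INBOX l.31174)

HONEST FRAMING. PROVED statement about the first-order MODEL of the PAD-4 anchor (seat s4-prove-1 g23, TRACK S4-PUSH lane
(ii), 2026-08-27). `TheoremLZetaMain` ∕ `TheoremLZeta` (p505821) stay kernel-OPEN (`@[conjecture]`); nothing here proves them.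
WHAT IS PROVED (`rayRule_lower`): in ANY design `D` with sections `φ` satisfying `Minimal`, if the column of an
`N`-constituent `X = N i` charged on a factor `σ` is solvable (`LowerColumnSolvable`) at the ONE Weil direction
`κ₀ = E_{fσ}` for some other factor `f ≠ σ` (charged or not), then `X` has a σ-RAY PARTNER STRICTLY BELOW IT WITH AN ENTRY:
some `P j` in `X`'s layer with the same letter as `X` on every factor `g ≠ σ`, a smaller σ-charge (uncharged, or `X`'s
phase), and a non-zero section coordinate `φ i j a`, `a ∈ idxH0 (N i) (P j)`. This is PAD4-DIAGCLOSURE §1 THEOREM C′ (⇒)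
∕ PAD4-THEOREM-L §0 «LINE RULE» ∕ §5 (P0) «RAY RULE (N)» in the kernel, in the strong form the pencil notes for `N`'s: NO
second charged factor is needed on the lower side (every partner `P ≤ X` is uncharged where `X` is). MECHANISM: the
`w_{ζ_f}`-image of the diagonal row `r = i` at the Künneth component `qPair σ f` equals `± c_σ ≠ 0` by row 781's
`ob_qPair_wImage_E_ne_zero` (S1); on the left-hand side every unknown `η_j` whose `P j` is not such a partner contributes
`0` to that image (`lowerTerm_wImage_eq_zero`): off `{σ, f}` a non-empty unknown piece (`q = 0`) and a non-empty section
piece force equal letters; on `f` a strictly smaller letter of `P j` makes the product the evaluation pairing onto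
`ξ̄_{ζ_f}` (`coef_neg_one_pos_self`, row 739), which `w_{ζ_f}` kills (`xiBar_B_sub_zetaBar_mul_xiBar_A`, row 781); and a
`P j` of `X`'s full class has `φ i j = 0` by `Minimal`. The UPPER ray rule (S2b, needs a second charged factor, [W5]) and
the top-flag combinatorics (F1)(F2) (S2c) are NOT in this file. No variety, sheaf or semiregularity map is constructed;
nothing here says HC ∕ HC_CM ∕ HC_AV holds; no fact, no definition, no instance, no notation. REUSE: rows 716 (model), 731
(`rel_eq_of_idx_zero_nonempty`, `layer_eq_of_idx_zero_nonempty`, `coefProd_eq_mul_erase`), 739 (`coef_neg_one_pos_self`,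
`prod_erase_update_target`, `mem_idxH2_self_qPair`), 781 (S1). Sizing: TIER2-SIZING-TheoremLZetaMain-prove-1-g23.md §5.
Typed ≠ proved ≠ endorsed.
-/

noncomputable section
namespace Summit.Ventures.HSemireg.Pad4FirstOrder
open Finset

/-! ## Index bookkeeping -/

/-- membership in the `H²` index set: a degree distribution of total degree `2` and a factorwise index. -/
theorem mem_idxH2_iff (Y X : Constituent) (t : (Fin 4 → ℕ) × (Fin 4 → ℕ × ℕ)) :
    t ∈ idxH2 Y X ↔ t.1 ∈ qDist2 ∧ ∀ g, t.2 g ∈ idx (rel Y X g) (t.1 g) := by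
  unfold idxH2
  simp only [mem_biUnion, mem_image, Fintype.mem_piFinset]
  constructor
  · rintro ⟨q, hq, o, ho, rfl⟩; exact ⟨hq, ho⟩
  · rintro ⟨hq, ho⟩; exact ⟨t.1, hq, t.2, ho, rfl⟩

/-- membership in the section index set is factorwise. -/
theorem mem_idxH0_iff (Y X : Constituent) (a : Fin 4 → ℕ × ℕ) :
    a ∈ idxH0 Y X ↔ ∀ g, a g ∈ idx (rel Y X g) 0 := Fintype.mem_piFinset

/-- `H⁰` of a negative letter is `0`. -/
theorem idx_neg_zero (d : ℕ) (k : Fin 4) : idx (Rel.neg d k) 0 = ∅ := by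
  unfold idx; split <;> simp_all

/-- `qPair σ f` vanishes off `{σ, f}`. -/
theorem qPair_of_ne {σ f g : Fin 4} (hσ : g ≠ σ) (hf : g ≠ f) : qPair σ f g = 0 := by
  simp [qPair, hσ, hf]

/-- `qPair σ f f = 1`. -/
theorem qPair_right (σ f : Fin 4) : qPair σ f f = 1 := by simp [qPair]

/-- the class of `P − X` on a factor where `P` is STRICTLY BELOW `X` on `X`'s ray (or uncharged under a charged `X`): the
negative letter `−(c_X − c_P) ℓ_{ζ_X}`. -/
theorem rel_of_lt (P X : Constituent) (g : Fin 4) (hl : P.layer = X.layer) (hlt : P.charge g < X.charge g)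
    (hph : P.charge g = 0 ∨ X.phase g = P.phase g) :
    rel P X g = Rel.neg (X.charge g - P.charge g) (X.phase g) := by
  unfold rel
  rw [if_neg (not_not.mpr hl), if_neg (by omega), if_neg (by omega)]
  rcases Nat.eq_zero_or_pos (P.charge g) with h0 | hpos
  · rw [if_pos h0, h0, Nat.sub_zero]
  · have hph' : P.phase g = X.phase g := (hph.resolve_left (by omega)).symm
    rw [if_neg (by omega), if_neg (not_not.mpr hph'), if_neg (by omega), if_pos hlt]

/-! ## The contributor lemma: who feeds the `w_{ζ_f}`-image of the diagonal row -/

/-- **CONTRIBUTOR LEMMA.** Fix `X`, a candidate partner `P`, factors `σ ≠ f`, an unknown index `u ∈ idxH2 P X` on the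
component `qPair σ f` and a section index `a ∈ idxH0 X P`. If on some factor `g₁ ≠ σ` the letters of `X` and `P` differ
(`rel X P g₁ ≠ zero`), then the `w_{ζ_f}`-combination of the two `coefProd` coefficients (target `ē_B` resp. `ē_A` on `f`,
`ē_A` elsewhere) VANISHES: for `g₁ ∉ {σ, f}` the situation is vacuous (`P < X` on `g₁` leaves no degree-`0` unknown piece),
for `g₁ = f` the `f`-factor is the evaluation pairing onto `ξ̄_{ζ_f}`, killed by `w_{ζ_f}`. -/
theorem coefProd_wImage_eq_zero (X P : Constituent) (σ f : Fin 4) (hσf : σ ≠ f)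
    (u : (Fin 4 → ℕ) × (Fin 4 → ℕ × ℕ)) (hu : u ∈ idxH2 P X) (hu1 : u.1 = qPair σ f)
    (a : Fin 4 → ℕ × ℕ) (ha : a ∈ idxH0 X P) (g₁ : Fin 4) (hg₁ : g₁ ≠ σ) (hne : rel X P g₁ ≠ Rel.zero) :
    coefProd (rel P X) (rel X P) (qPair σ f) u.2 a (Function.update (fun _ => ((0 : ℕ), (0 : ℕ))) f (1, 0)) -
      zetaBar (X.phase f) *
        coefProd (rel P X) (rel X P) (qPair σ f) u.2 a (Function.update (fun _ => ((0 : ℕ), (0 : ℕ))) f (0, 0)) = 0 := by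
  -- the letters on `g₁`: `P` strictly below `X` on `X`'s ray
  have hag : (idx (rel X P g₁) 0).Nonempty := ⟨a g₁, (mem_idxH0_iff X P a).1 ha g₁⟩
  have hl : X.layer = P.layer := layer_eq_of_idx_zero_nonempty X P g₁ hag
  rcases rel_eq_of_idx_zero_nonempty X P g₁ hag with ⟨hz, -, -⟩ | ⟨hpos, hlt, hph⟩
  · exact absurd hz hne
  have hneg : rel P X g₁ = Rel.neg (X.charge g₁ - P.charge g₁) (X.phase g₁) := rel_of_lt P X g₁ hl.symm hlt hph
  have hug : u.2 g₁ ∈ idx (rel P X g₁) (u.1 g₁) := ((mem_idxH2_iff P X u).1 hu).2 g₁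
  rw [hu1, hneg] at hug
  by_cases hgf : g₁ = f
  · subst hgf
    -- the `f`-factor is the evaluation pairing onto `ξ̄_{ζ_f}`; `w_{ζ_f}` kills it
    rw [coefProd_eq_mul_erase _ _ _ _ _ _ g₁, coefProd_eq_mul_erase _ _ _ _ _ (Function.update _ g₁ (0, 0)) g₁,
      prod_erase_update_target, prod_erase_update_target, Function.update_self, Function.update_self, qPair_right,
      hneg, hpos, coef_neg_one_pos_self, coef_neg_one_pos_self]
    by_cases hι : a g₁ = u.2 g₁
    · rw [if_pos hι, if_pos hι]
      have hw := xiBar_B_sub_zetaBar_mul_xiBar_A (X.phase g₁)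
      linear_combination (∏ g ∈ univ.erase g₁, coef (rel P X g) (qPair σ g₁ g) (u.2 g) (rel X P g) (a g)
        ((fun _ => ((0 : ℕ), (0 : ℕ))) g)) * hw
    · rw [if_neg hι, if_neg hι]; ring
  · -- vacuous: no degree-`0` unknown piece under a negative letter
    rw [qPair_of_ne hg₁ hgf, idx_neg_zero] at hug
    simp at hug

/-! ## The lower ray rule -/

/-- **THE LOWER RAY RULE (THEOREM C′ «only if» at an `N`-constituent, in the kernel).** In any design with `Minimal`
sections, if the column of `X = N i`, charged on `σ`, is solvable at `κ₀ = E_{fσ}` for some `f ≠ σ`, then some `P j` is a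
σ-ray partner strictly below `X` — same layer, the same letter as `X` on every `g ≠ σ`, σ-charge smaller (and uncharged or
of `X`'s σ-phase) — joined to `X` by a non-zero section coordinate. In particular `(∀ κ, LowerColumnSolvable φ κ i)`
(one half of `H2`) forces such a partner at EVERY charged factor of every `N`-constituent. -/
theorem rayRule_lower (D : Design) (φ : D.Sections) (hmin : D.Minimal φ) (i : Fin D.nN) (σ f : Fin 4)
    (hσf : σ ≠ f) (hσ : (D.N i).charge σ ≠ 0)
    (h : D.LowerColumnSolvable φ (Matrix.of fun a b => if a = f ∧ b = σ then (1 : ℂ) else 0) i) :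
    ∃ j : Fin D.nP, (D.P j).layer = (D.N i).layer ∧ (∀ g, g ≠ σ → rel (D.N i) (D.P j) g = Rel.zero) ∧
      (D.P j).charge σ < (D.N i).charge σ ∧ ((D.P j).charge σ = 0 ∨ (D.N i).phase σ = (D.P j).phase σ) ∧
      ∃ a ∈ idxH0 (D.N i) (D.P j), φ i j a ≠ 0 := by
  classical
  obtain ⟨η, hη⟩ := h
  -- the two coordinates of the diagonal row we combine: `f ↦ ē_B` and `f ↦ ē_A` on the component `qPair σ f`
  have hoB : (qPair σ f, Function.update (fun _ => ((0 : ℕ), (0 : ℕ))) f (1, 0)) ∈ idxH2 (D.N i) (D.N i) :=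
    mem_idxH2_self_qPair _ σ f hσf _ fun g => by
      by_cases hg : g = f
      · subst hg; exact Or.inr ⟨Function.update_self .., Or.inr rfl⟩
      · exact Or.inl (Function.update_of_ne hg ..)
  have hoA : (qPair σ f, Function.update (fun _ => ((0 : ℕ), (0 : ℕ))) f (0, 0)) ∈ idxH2 (D.N i) (D.N i) :=
    mem_idxH2_self_qPair _ σ f hσf _ fun g => Or.inl (by
      by_cases hg : g = f
      · subst hg; exact Function.update_self ..
      · exact Function.update_of_ne hg ..)
  have eB := hη i _ hoB
  have eA := hη i _ hoA
  rw [if_pos rfl] at eB eA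
  -- the `w_{ζ_f}`-image of the demand is non-zero (S1) …
  have key : D.lowerLHS φ η i i (qPair σ f, Function.update (fun _ => ((0 : ℕ), (0 : ℕ))) f (1, 0)) -
      zetaBar ((D.N i).phase f) *
        D.lowerLHS φ η i i (qPair σ f, Function.update (fun _ => ((0 : ℕ), (0 : ℕ))) f (0, 0)) ≠ 0 := by
    rw [eB, eA]; exact ob_qPair_wImage_E_ne_zero (D.N i) σ f hσf hσ _ rfl
  -- … so some term of the left-hand side survives; every survivor is a strict σ-ray partner with an entry
  by_contra hno
  push Not at hno
  apply key
  simp only [Design.lowerLHS, Finset.mul_sum, ← Finset.sum_sub_distrib]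
  refine Finset.sum_eq_zero fun j _ => Finset.sum_eq_zero fun u hu => Finset.sum_eq_zero fun a ha => ?_
  by_cases hu1 : u.1 = qPair σ f
  swap
  · rw [if_neg hu1, if_neg hu1]; ring
  rw [if_pos hu1, if_pos hu1]
  -- is `P j` of `X`'s class, a strict σ-ray partner, or neither?
  by_cases hoff : ∃ g₁, g₁ ≠ σ ∧ rel (D.N i) (D.P j) g₁ ≠ Rel.zero
  · obtain ⟨g₁, hg₁, hne⟩ := hoff
    have hc := coefProd_wImage_eq_zero (D.N i) (D.P j) σ f hσf u hu hu1 a ha g₁ hg₁ hne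
    linear_combination (φ i j a * η j u.1 u.2) * hc
  · push Not at hoff
    by_cases hσ0 : rel (D.N i) (D.P j) σ = Rel.zero
    · -- same class on every factor: no isomorphism entry (`Minimal`)
      have hall : ∀ g, rel (D.N i) (D.P j) g = Rel.zero := fun g => by
        by_cases hg : g = σ
        · subst hg; exact hσ0
        · exact hoff g hg
      rw [hmin i j hall a]; ring
    · -- a strict σ-ray partner: by `hno` its entry vanishes
      have hag : (idx (rel (D.N i) (D.P j) σ) 0).Nonempty := ⟨a σ, (mem_idxH0_iff _ _ a).1 ha σ⟩
      have hl := layer_eq_of_idx_zero_nonempty _ _ σ hag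
      rcases rel_eq_of_idx_zero_nonempty _ _ σ hag with ⟨hz, -, -⟩ | ⟨-, hlt, hph⟩
      · exact absurd hz hσ0
      rw [hno j hl.symm hoff hlt hph a ha]; ring

end Summit.Ventures.HSemireg.Pad4FirstOrder
end
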